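import Literature.MathematicalPhysics.QuantumFieldTheory.Balaban1983to89.B9Thm312WholeLeafRelH
import Literature.MathematicalPhysics.QuantumFieldTheory.Balaban1983to89.B9Thm312WholeBlocksRel

/-!
# `Balaban1983to89.B9Thm312WholeLeafAll` — [B9] Theorem 3.12 (p. 423) AS THE WHOLE PRINTED LEAF `B9.Thm312Printed` AT THE PINS, with the
# L² block (3.46) and the Hölder block (3.43)–(3.45) of G, G₁ PROVED INSIDE from the per-class schemas — the displayed residual of row 20
# shrinks to the one Hölder member of (3.133)

T. Bałaban, *Propagators for lattice gauge theories in a background field*, Commun. Math. Phys. **99** (1985) 389–434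
[`Balaban1985BackgroundPropagators`, "B9"]; [4] = T. Bałaban, *Propagators and renormalization transformations for lattice
gauge theories. II*, Commun. Math. Phys. **96** (1984) 223–250 [`Balaban1984PropagatorsII`].

statement-level skeleton of published theorems with citation tags; proofs where landed; nothing here is a claim about the
Yang–Mills mass gap

THE PRINTED LOCI are those of `…B9Thm312WholeLeafCoGlob` and `…B9Thm312WholeClasses` (verbatim there); the sentence carried out here is
p. 422: *"This inequality [(3.131)] and Theorem 3.3 for G₀ imply a convergence of the series (3.130), for α₀ sufficiently small, in all norms
appearing on the left-hand sides of the inequalities (3.42)–(3.47), except the inequality involving the Laplace operator in (3.42). Thus we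
have Theorem 3.3. for G, with this exception."* and its twin for G₁ (p. 423).

WHY THIS FILE (successor of `…B9Thm312WholeLeafRelH.thm312Printed_of_stepRelH`, same seat).  That leaf PROVES the sup classes of row 20 and
DISPLAYS (`hres`) the L² block (3.46) and the Hölder block (3.43)–(3.45) of G_D, G₁ together with the Hölder member of (3.133).  Here the two
blocks are PROVED INSIDE, per member and per configuration, by `B9Thm312WholeBlocksRel.l2Block_of_step` ∕ `holder_of_step` (A = G with Δ′_π, A =
G₁ with Δ′_π + Δ⁽²⁾_π) from: Theorem 3.3 for G₀ in the Hölder and L² classes (`Thm33G0H`, `Thm33G0L2` — schemas of printed shape, as `Thm33G0`),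
the perturbation step in those classes (`StepH`, `StepL2` — as `Step`, `LeftStep`), the transposition letters (G, G₁ symmetric, (∇_UG)ᵀ =
G∇\*_U), the probe ∕ input-norm ∕ Laplacian letters `𝔭`, `bH`, `Lap`, and n06-k's RELATIVE co-readings `L2ReadsRel` (×12), `H1ReadsRel` (×2),
`InputReadsRel` (×2).  What stays displayed: the Hölder member ‖ζ∇H(·,y′)‖_β of (3.133) for H, H₁ (its probe reading is not typed yet).

WHAT THIS FILE PROVES (one theorem — 0 `def`, 0 named fact, 0 sorry): ★ `thm312Printed_of_stepAll` — conclusion and pins of row 20 unchanged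
(`B9.Thm312Printed d c35 geo bg GD G₁ Hk H₁k (HasRWExpOfOps) (HasRWExpHOfOps) (PosDefKOfOps)`); inputs = those of `thm312Printed_of_stepRelH` with
`hres` REPLACED by its (3.133)-Hölder line alone, plus the letters, schemas, readings and numerics listed above; *"for α₀ sufficiently small"*
gains the L² smallness B₂θ₂(Mα₀)c² ≦ ½.

HONEST SCOPE.  Nothing of print is asserted; kernel-checked bookkeeping — NOT a node discharge, NOT summit progress; one finite lattice at a
time; nothing continuum, nothing about the mass gap.  Cell `pub-ymgap` (HUMAN RULING D-0062), Track A node N06 [B9], N06-ASSIGNMENT v1 row 20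
(bundle F7), seat `pub-ymgap-dag-n06-l` (g4), 2026-08-27.
-/

namespace Literature.MathematicalPhysics.QuantumFieldTheory.Balaban1983to89.B9Thm312WholeLeafAll

open Literature.MathematicalPhysics.QuantumFieldTheory.Balaban1983to89
open Finset B6RandomWalk B6RandomWalkHom B9Thm34Ext B9Thm37Glue B9Thm37GlueCor36 B11SectG B9SectDSup B9SectDL2Decay
open B9Thm37AllNorms B9Thm37AllNormsInstances B9FromB6 B9FromB6ModelSignsOn B9SectBStepWhole B9Thm312Whole B9Thm312WholeLeaf
open B9Thm312WholeLeft B9Thm312WholeH B9Thm312WholeLeafLeftGlob B9Ineq347CoReading B9SectCDiffDict B9CoRealizesRel B9CoRealizesHRel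
open B9RWSums343Holder B9RWSumsReadsRel B9Ineq347 B9Thm312WholeClasses B9Thm312WholeHolder B9Thm312WholeL2 B9Thm312WholeBlocksRel

noncomputable section

/-! ## §0 Bookkeeping helpers -/

section Helpers

variable {g : B9.Geometry} {B : B9.Backgrounds} {P : g.Loc → Prop}

/-- «Of course with different constants» for the Hölder block (3.43)–(3.45): weakening the three constant functions ON THE PRINTED RANGES 0 ≦ β < 1,
0 < ε ≦ 1 and the rate (the version of `B9SectBStepWhole.ineq343_345_mono` that asks nothing off the ranges).
[cite: Balaban1985BackgroundPropagators, (3.43)–(3.45) p.398 + p.423 (bookkeeping)] -/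
theorem ineq343_345_mono_on (S : ModelSignsOn g P) {K : B9.KernelFamily g B} {Bβ Bβ' Bε Bε' : ℝ → ℝ} {Bεβ Bεβ' : ℝ → ℝ → ℝ} {δ₀ δ₀' : ℝ}
    {U : B.Cfg} (h : B9.Ineq343_345 K Bβ Bε Bεβ δ₀ U) (hlen : ∀ y : g.Site, 0 < g.len y)
    (hβ : ∀ β, 0 ≤ β → β < 1 → Bβ β ≤ Bβ' β ∧ 0 ≤ Bβ' β) (hε : ∀ ε, 0 < ε → ε ≤ 1 → Bε ε ≤ Bε' ε ∧ 0 ≤ Bε' ε)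
    (hεβ : ∀ ε β, 0 < ε → ε ≤ 1 → 0 ≤ β → β < 1 → Bεβ ε β ≤ Bεβ' ε β ∧ 0 ≤ Bεβ' ε β) (hδ : δ₀' ≤ δ₀) :
    B9.Ineq343_345 K Bβ' Bε' Bεβ' δ₀' U := by
  have hexp : ∀ y y' : g.Site, Real.exp (-(δ₀ * g.dist y y')) ≤ Real.exp (-(δ₀' * g.dist y y')) := fun y y' =>
    Real.exp_le_exp.mpr (neg_le_neg (mul_le_mul_of_nonneg_right hδ (S.dist_nonneg y y')))
  refine ⟨fun β lam ζ y y' h0 h1 hζ hs => ?_, fun ε lam y y' h0 h1 hs => ?_, fun ε β lam ζ y y' hε0 hε1 h0 h1 hζ hs => ?_⟩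
  · obtain ⟨hle, hnn⟩ := hβ β h0 h1
    have hP : 0 ≤ (g.len y) ^ (1 - β) * g.cutH β ζ := mul_nonneg (Real.rpow_nonneg (hlen y).le _) (S.cutH_nonneg β ζ)
    calc K.h1 U lam β ζ ≤ Bβ β * (g.len y) ^ (1 - β) * g.cutH β ζ * Real.exp (-(δ₀ * g.dist y y')) * g.supNorm lam :=
          h.1 β lam ζ y y' h0 h1 hζ hs
      _ = Bβ β * Real.exp (-(δ₀ * g.dist y y')) * ((g.len y) ^ (1 - β) * g.cutH β ζ * g.supNorm lam) := by ring
      _ ≤ Bβ' β * Real.exp (-(δ₀' * g.dist y y')) * ((g.len y) ^ (1 - β) * g.cutH β ζ * g.supNorm lam) :=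
          mul_le_mul_of_nonneg_right (mul_le_mul hle (hexp y y') (Real.exp_nonneg _) hnn) (mul_nonneg hP (S.supNorm_nonneg lam))
      _ = Bβ' β * (g.len y) ^ (1 - β) * g.cutH β ζ * Real.exp (-(δ₀' * g.dist y y')) * g.supNorm lam := by ring
  · obtain ⟨hle, hnn⟩ := hε ε h0 h1
    have hP : 0 ≤ g.holder ε lam + g.supNorm lam := add_nonneg (S.holder_nonneg ε lam) (S.supNorm_nonneg lam)
    calc K.e4 U lam y ≤ Bε ε * Real.exp (-(δ₀ * g.dist y y')) * (g.holder ε lam + g.supNorm lam) := h.2.1 ε lam y y' h0 h1 hs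
      _ ≤ Bε' ε * Real.exp (-(δ₀' * g.dist y y')) * (g.holder ε lam + g.supNorm lam) :=
          mul_le_mul_of_nonneg_right (mul_le_mul hle (hexp y y') (Real.exp_nonneg _) hnn) hP
  · obtain ⟨hle, hnn⟩ := hεβ ε β hε0 hε1 h0 h1
    have hP : 0 ≤ (g.len y) ^ (-β) * g.cutH β ζ := mul_nonneg (Real.rpow_nonneg (hlen y).le _) (S.cutH_nonneg β ζ)
    have hQ : 0 ≤ g.holder (β + ε) lam + g.supNorm lam := add_nonneg (S.holder_nonneg _ lam) (S.supNorm_nonneg lam)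
    calc K.h2 U lam β ζ ≤ Bεβ ε β * (g.len y) ^ (-β) * g.cutH β ζ * Real.exp (-(δ₀ * g.dist y y')) *
          (g.holder (β + ε) lam + g.supNorm lam) := h.2.2 ε β lam ζ y y' hε0 hε1 h0 h1 hζ hs
      _ = Bεβ ε β * Real.exp (-(δ₀ * g.dist y y')) * ((g.len y) ^ (-β) * g.cutH β ζ * (g.holder (β + ε) lam + g.supNorm lam)) := by
          ring
      _ ≤ Bεβ' ε β * Real.exp (-(δ₀' * g.dist y y')) * ((g.len y) ^ (-β) * g.cutH β ζ * (g.holder (β + ε) lam + g.supNorm lam)) :=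
          mul_le_mul_of_nonneg_right (mul_le_mul hle (hexp y y') (Real.exp_nonneg _) hnn) (mul_nonneg hP hQ)
      _ = Bεβ' ε β * (g.len y) ^ (-β) * g.cutH β ζ * Real.exp (-(δ₀' * g.dist y y')) * (g.holder (β + ε) lam + g.supNorm lam) := by
          ring

/-- The uniform bound of the L² constant `constL2` along the family: with (1 − θc)⁻¹ ≦ 2, (1 − B₂θ₂c²)⁻¹ ≦ 2, θ_D ≦ t_D, θ₂ ≦ t₂ and the three
transfer constants below Λ_u, `constL2 B₀ θ θ_D B₂ θ₂ c Λ₁ Λ_h Λ₋ ≦ 2B₀Λ_u + (B₀ + t_D(2B₀)c + 2B₀)Λ_u + (B₂ + B₂(t₂(2B₂)c)c)(1 + Λ_u + Λ_u)`.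
[cite: Balaban1985BackgroundPropagators, Thm 3.12 p.423 («for α₀ sufficiently small», bookkeeping)] -/
theorem constL2_le {B₀ θ θD tD B₂ θ₂ t₂ c Λ₁ Λh Λm Λu : ℝ} (hB₀ : 0 ≤ B₀) (hB₂ : 0 ≤ B₂) (hc : 0 ≤ c) (hθD : 0 ≤ θD)
    (hθDle : θD ≤ tD) (hθ₂ : 0 ≤ θ₂) (hθ₂le : θ₂ ≤ t₂) (hq : θ * c ≤ 1 / 2) (hq₂ : B₂ * θ₂ * c * c ≤ 1 / 2)
    (hΛ₁ : 0 ≤ Λ₁) (hΛ₁le : Λ₁ ≤ Λu) (hΛh : 0 ≤ Λh) (hΛhle : Λh ≤ Λu) (hΛm : 0 ≤ Λm) (hΛmle : Λm ≤ Λu) :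
    constL2 B₀ θ θD B₂ θ₂ c Λ₁ Λh Λm ≤
      2 * B₀ * Λu + (B₀ + tD * (2 * B₀) * c + 2 * B₀) * Λu + (B₂ + B₂ * (t₂ * (2 * B₂) * c) * c) * (1 + Λu + Λu) := by
  have hX0 : 0 ≤ (1 - θ * c)⁻¹ := inv_nonneg.mpr (by linarith)
  have hX : B₀ * (1 - θ * c)⁻¹ ≤ 2 * B₀ := const_le_two_mul hB₀ hq
  have hBX0 : 0 ≤ B₀ * (1 - θ * c)⁻¹ := mul_nonneg hB₀ hX0
  have hY0 : 0 ≤ (1 - B₂ * θ₂ * c * c)⁻¹ := inv_nonneg.mpr (by linarith)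
  have hY : B₂ * (1 - B₂ * θ₂ * c * c)⁻¹ ≤ 2 * B₂ := const_le_two_mul hB₂ hq₂
  have hBY0 : 0 ≤ B₂ * (1 - B₂ * θ₂ * c * c)⁻¹ := mul_nonneg hB₂ hY0
  have htD : 0 ≤ tD := hθD.trans hθDle
  have ht₂ : 0 ≤ t₂ := hθ₂.trans hθ₂le
  have hΛu : 0 ≤ Λu := hΛ₁.trans hΛ₁le
  -- term 1
  have h1 : B₀ * (1 - θ * c)⁻¹ * Λ₁ ≤ 2 * B₀ * Λu := mul_le_mul hX hΛ₁le hΛ₁ (by linarith)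
  -- term 2
  have h2a : θD * (B₀ * (1 - θ * c)⁻¹) * c ≤ tD * (2 * B₀) * c :=
    mul_le_mul_of_nonneg_right (mul_le_mul hθDle hX hBX0 htD) hc
  have h2b : B₀ + θD * (B₀ * (1 - θ * c)⁻¹) * c + B₀ * (1 - θ * c)⁻¹ ≤ B₀ + tD * (2 * B₀) * c + 2 * B₀ := by linarith
  have h2c : 0 ≤ B₀ + θD * (B₀ * (1 - θ * c)⁻¹) * c + B₀ * (1 - θ * c)⁻¹ :=
    add_nonneg (add_nonneg hB₀ (mul_nonneg (mul_nonneg hθD hBX0) hc)) hBX0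
  have h2 : (B₀ + θD * (B₀ * (1 - θ * c)⁻¹) * c + B₀ * (1 - θ * c)⁻¹) * Λh ≤ (B₀ + tD * (2 * B₀) * c + 2 * B₀) * Λu :=
    mul_le_mul h2b hΛhle hΛh (h2c.trans h2b)
  -- term 3
  have h3a : θ₂ * (B₂ * (1 - B₂ * θ₂ * c * c)⁻¹) * c ≤ t₂ * (2 * B₂) * c :=
    mul_le_mul_of_nonneg_right (mul_le_mul hθ₂le hY hBY0 ht₂) hc
  have h3a0 : 0 ≤ θ₂ * (B₂ * (1 - B₂ * θ₂ * c * c)⁻¹) * c := mul_nonneg (mul_nonneg hθ₂ hBY0) hc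
  have h3b : B₂ + B₂ * (θ₂ * (B₂ * (1 - B₂ * θ₂ * c * c)⁻¹) * c) * c ≤ B₂ + B₂ * (t₂ * (2 * B₂) * c) * c := by
    have := mul_le_mul_of_nonneg_right (mul_le_mul_of_nonneg_left h3a hB₂) hc
    linarith
  have h3c : 0 ≤ B₂ + B₂ * (θ₂ * (B₂ * (1 - B₂ * θ₂ * c * c)⁻¹) * c) * c :=
    add_nonneg hB₂ (mul_nonneg (mul_nonneg hB₂ h3a0) hc)
  have h3 : (B₂ + B₂ * (θ₂ * (B₂ * (1 - B₂ * θ₂ * c * c)⁻¹) * c) * c) * (1 + Λ₁ + Λm) ≤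
      (B₂ + B₂ * (t₂ * (2 * B₂) * c) * c) * (1 + Λu + Λu) :=
    mul_le_mul h3b (by linarith) (by linarith) (h3c.trans h3b)
  unfold constL2
  linarith

end Helpers

/-! ## The leaf of row 20 with both blocks proved inside -/

section Family

variable {I : Type} {d : ℕ} {c35 : ℝ} {geo : I → B9.Geometry} {bg : I → B9.Backgrounds}
variable [∀ i, Fintype (geo i).Site] [∀ i, DecidableEq (geo i).Site]
variable {X Y Z W PX PY : I → Type} [∀ i, Fintype (X i)] [∀ i, DecidableEq (X i)] [∀ i, Fintype (Y i)]
  [∀ i, Fintype (Z i)] [∀ i, Fintype (W i)] [∀ i, Fintype (PX i)] [∀ i, Fintype (PY i)]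

omit [∀ i, Fintype (X i)] [∀ i, DecidableEq (X i)] [∀ i, Fintype (Y i)] [∀ i, Fintype (Z i)] [∀ i, Fintype (W i)]
  [∀ i, Fintype (geo i).Site] [∀ i, DecidableEq (geo i).Site] [∀ i, Fintype (PX i)] [∀ i, Fintype (PY i)] in
/-- Arithmetic of *"for α₀ sufficiently small"*: t ≧ 0 and m ≦ (2(t + 1))⁻¹ give tm ≦ ½. [folklore] -/
private theorem small_aux₄ {t m : ℝ} (ht : 0 ≤ t) (hm : m ≤ (2 * (t + 1))⁻¹) : t * m ≤ 1 / 2 := by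
  have hpos : 0 < 2 * (t + 1) := by linarith
  have h1 : t * m ≤ t * (2 * (t + 1))⁻¹ := mul_le_mul_of_nonneg_left hm ht
  have h2 : t * (2 * (t + 1))⁻¹ ≤ 1 / 2 := by
    rw [← div_eq_mul_inv, div_le_iff₀ hpos]
    linarith
  linarith

-- heartbeat budget (v1.1, pre-emptive): this one-block proof elaborates at ≈ 130–160k heartbeats on the farm — the band in which two
-- sibling leaves failed `lake build` at the 200k default (2026-08-27); statement and proof byte-identical to v1.
set_option maxHeartbeats 400000 in
/-- ★ **THEOREM 3.12 AS THE WHOLE PRINTED LEAF `B9.Thm312Printed`, AT THE PINS — THE L² BLOCK (3.46) AND THE HÖLDER BLOCK (3.43)–(3.45) OF G, G₁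
PROVED INSIDE** (p. 423).  Inputs: those of `B9Thm312WholeLeafRelH.thm312Printed_of_stepRelH` VERBATIM except that `hres` keeps ONLY the Hölder
member of (3.133) for H, H₁, plus: the probe letters `𝔭 i` (n06-k `HolderProbes`), the input Hölder norms `bH i`, the Laplacian letters `Lap i`;
Theorem 3.3 for G₀ in the Hölder and L² classes (`hG0C : Thm33G0H ∧ Thm33G0L2`); the perturbation steps in those classes with the constants
θ_H·(Mα₀), θ₂·(Mα₀) (`hstepC : StepH ∧ StepL2`); the transposition letters (`hsym`, `htr`); the relative co-readings of the (3.43)–(3.46)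
quantities of `GD i`, `G₁ i` (`hl2R`, `hH1R`, `hIR`); the rate ρ_f (0 < ρ_f, ρ_f + σ ≦ (1 − α)ρ, ρ_f + 2σ + αρ ≦ ρ) and 0 ≦ α.  PROVED INSIDE:
(3.42)₁,₂,₃, (3.46)₀₋₅, (3.43)–(3.45), (3.47)₀,₁,₂ for G_D and G₁ (`B9Thm312WholeBlocksRel.l2Block_of_step` ∕ `holder_of_step`, twice per member),
the two sup members of (3.133), Theorem 3.11, the pins.  RESIDUAL DISPLAYED: the Hölder member of (3.133).  Nothing of print asserted; NOT a
node discharge. [cite: Balaban1985BackgroundPropagators, Thm 3.12 pp.421–423 + (3.41)–(3.47) pp.397–398 + (3.126) p.420 + (3.129) p.421 + (3.132)–(3.133) p.422; Balaban1984PropagatorsII, (2.51)–(2.52) p.232 + Lemma 2.1 (2.60)–(2.61) p.234] -/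
theorem thm312Printed_of_stepAll (𝔬 : ∀ i, Ops (geo i) (bg i) (X i) (Y i) (Z i) (W i)) (R₀ : I → ℝ) (H₀ : I → Prop)
    (𝔭 : ∀ i, HolderProbes (geo i) (bg i) (X i) (Y i) (PX i) (PY i))
    (bH : ∀ i, ℝ → BlockNorm (toB6 (geo i) (R₀ i) (H₀ i)) (Y i → ℝ)) (Lap : ∀ i, (bg i).Cfg → Module.End ℝ (X i → ℝ))
    (GD G₁ : ∀ i, B9.KernelFamily (geo i) (bg i)) (Hk H₁k : ∀ i, B9.HKernel (geo i) (bg i))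
    (ev : ∀ i, (geo i).Loc → X i → ℝ) (evY : ∀ i, (geo i).Loc → Y i → ℝ) {P : ∀ i, (geo i).Loc → Prop}
    (Rel : ∀ i, (geo i).Site → (geo i).Site → Prop) [∀ i, DecidableRel (Rel i)] (m : ℕ)
    (θ₁ θD θH θ₂ r₁ B₀ B₂ δ₀ δK σ c ρ ρf a₁ M₁ ML δ₁ B₃ δ₃ α Lc : ℝ) (Bh Bi Bβ : ℝ → ℝ) (Bi2 : ℝ → ℝ → ℝ)
    (hθ₁ : 0 ≤ θ₁) (hθD : 0 ≤ θD) (hθH : 0 ≤ θH) (hθ₂ : 0 ≤ θ₂) (hr₁ : 0 ≤ r₁) (hB₀ : 0 ≤ B₀) (hB₂ : 0 ≤ B₂) (hB₃ : 0 ≤ B₃)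
    (hσ : 0 ≤ σ) (hρ : 0 < ρ) (hρS : ρ ≤ δ₀) (hρδ : ρ + σ ≤ δK) (hρ₃ : ρ + σ ≤ δ₃) (hc : 0 ≤ c) (ha₁ : 0 < a₁) (hM₁ : 0 < M₁)
    (hδ₁ : 0 < δ₁) (hα : α ≤ 1 / 2) (hα0 : 0 ≤ α) (hρf : 0 < ρf) (hρf1 : ρf + σ ≤ (1 - α) * ρ) (hρf2 : ρf + 2 * σ + α * ρ ≤ ρ)
    (hBh : ∀ β, 0 ≤ β → β < 1 → 0 ≤ Bh β) (hBi : ∀ ε, 0 < ε → ε ≤ 1 → 0 ≤ Bi ε)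
    (hBi2 : ∀ ε β, 0 < ε → ε ≤ 1 → 0 ≤ β → β < 1 → 0 ≤ Bi2 ε β) (hBβ : ∀ β, 0 ≤ Bβ β)
    (hgeo : ∀ i, GeoOK (geo i)) (S : ∀ i, ModelSignsOn (geo i) (P i))
    (hL1 : ∀ i, 1 ≤ (geo i).L) (hLle : ∀ i, (geo i).L ≤ Lc) (hη : ∀ i, 0 < (geo i).eta)
    (hrow : ∀ i, ML ≤ (geo i).M → RowSum (toB6 (geo i) (R₀ i) (H₀ i)) σ c)
    (hL21 : ∀ δ : ℝ, 0 < δ → ∃ ML' c' : ℝ, Lemma21AboveG geo R₀ H₀ δ α ML' c')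
    (hsat : ∀ (i : I) (n : Fin 4) (B' δ' : ℝ),
      (∀ a a' b, Rel i a a' → maj342 (geo i) n B' δ' a b = maj342 (geo i) n B' δ' a' b) ∧
      (∀ a b b', Rel i b b' → maj342 (geo i) n B' δ' a b = maj342 (geo i) n B' δ' a b'))
    (hmult : ∀ (i : I) (y' : (geo i).Site), (Finset.univ.filter (fun y'' => Rel i y'' y')).card ≤ m)
    (hRdist : ∀ (i : I) (a a' b : (geo i).Site), Rel i a a' → (geo i).dist a b = (geo i).dist a' b)
    (hRdist' : ∀ (i : I) (a b b' : (geo i).Site), Rel i b b' → (geo i).dist a b = (geo i).dist a b')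
    (hRlen : ∀ (i : I) (a a' : (geo i).Site), Rel i a a' → (geo i).len a = (geo i).len a')
    (hcoR : ∀ (i : I) (U : (bg i).Cfg),
      CoRealizesRel (GD i) 0 U (Rel i) (𝔬 i).blk (𝔬 i).blk (ev i) ((𝔬 i).G U) ∧
      CoRealizesRel (GD i) 2 U (Rel i) (𝔬 i).blk (𝔬 i).blkY (evY i) ((𝔬 i).G U ∘ₗ (𝔬 i).Dstar U) ∧
      CoRealizesRel (G₁ i) 0 U (Rel i) (𝔬 i).blk (𝔬 i).blk (ev i) ((𝔬 i).G1 U) ∧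
      CoRealizesRel (G₁ i) 2 U (Rel i) (𝔬 i).blk (𝔬 i).blkY (evY i) ((𝔬 i).G1 U ∘ₗ (𝔬 i).Dstar U))
    (hco1R : ∀ (i : I) (U : (bg i).Cfg),
      CoRealizesRel (GD i) 1 U (Rel i) (𝔬 i).blkY (𝔬 i).blk (ev i) ((𝔬 i).D U ∘ₗ (𝔬 i).G U) ∧
      CoRealizesRel (G₁ i) 1 U (Rel i) (𝔬 i).blkY (𝔬 i).blk (ev i) ((𝔬 i).D U ∘ₗ (𝔬 i).G1 U))
    (hcoHR : ∀ (i : I) (U : (bg i).Cfg),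
      CoRealizesHRel (Hk i) 0 U d (Rel i) (𝔬 i).blk (𝔬 i).blkZ ((𝔬 i).Hm U) ∧
      CoRealizesHRel (Hk i) 1 U d (Rel i) (𝔬 i).blkY (𝔬 i).blkZ ((𝔬 i).D U ∘ₗ (𝔬 i).Hm U) ∧
      CoRealizesHRel (H₁k i) 0 U d (Rel i) (𝔬 i).blk (𝔬 i).blkZ ((𝔬 i).H1m U) ∧
      CoRealizesHRel (H₁k i) 1 U d (Rel i) (𝔬 i).blkY (𝔬 i).blkZ ((𝔬 i).D U ∘ₗ (𝔬 i).H1m U))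
    (hcoG : ∀ (i : I) (U : (bg i).Cfg),
      CoReadsGlob (GD i) 0 U (𝔬 i).blk (𝔬 i).blk (ev i) ((𝔬 i).G U) ∧
      CoReadsGlob (GD i) 1 U (𝔬 i).blkY (𝔬 i).blk (ev i) ((𝔬 i).D U ∘ₗ (𝔬 i).G U) ∧
      CoReadsGlob (GD i) 2 U (𝔬 i).blk (𝔬 i).blkY (evY i) ((𝔬 i).G U ∘ₗ (𝔬 i).Dstar U) ∧
      CoReadsGlob (G₁ i) 0 U (𝔬 i).blk (𝔬 i).blk (ev i) ((𝔬 i).G1 U) ∧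
      CoReadsGlob (G₁ i) 1 U (𝔬 i).blkY (𝔬 i).blk (ev i) ((𝔬 i).D U ∘ₗ (𝔬 i).G1 U) ∧
      CoReadsGlob (G₁ i) 2 U (𝔬 i).blk (𝔬 i).blkY (evY i) ((𝔬 i).G1 U ∘ₗ (𝔬 i).Dstar U))
    (hl2R : ∀ (i : I) (U : (bg i).Cfg),
      (L2ReadsRel (R := R₀ i) (H := H₀ i) (GD i) 0 U (Rel i) (𝔬 i).blk (𝔬 i).blk (ev i) ((𝔬 i).G U) ∧
        L2ReadsRel (R := R₀ i) (H := H₀ i) (GD i) 1 U (Rel i) (𝔬 i).blkY (𝔬 i).blk (ev i) ((𝔬 i).D U ∘ₗ (𝔬 i).G U) ∧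
        L2ReadsRel (R := R₀ i) (H := H₀ i) (GD i) 2 U (Rel i) (𝔬 i).blk (𝔬 i).blkY (evY i) ((𝔬 i).G U ∘ₗ (𝔬 i).Dstar U) ∧
        L2ReadsRel (R := R₀ i) (H := H₀ i) (GD i) 3 U (Rel i) (𝔬 i).blk (𝔬 i).blk (ev i) (Lap i U ∘ₗ (𝔬 i).G U) ∧
        L2ReadsRel (R := R₀ i) (H := H₀ i) (GD i) 4 U (Rel i) (𝔬 i).blkY (𝔬 i).blkY (evY i)
          ((𝔬 i).D U ∘ₗ ((𝔬 i).G U ∘ₗ (𝔬 i).Dstar U)) ∧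
        L2ReadsRel (R := R₀ i) (H := H₀ i) (GD i) 5 U (Rel i) (𝔬 i).blk (𝔬 i).blk (ev i) ((𝔬 i).G U ∘ₗ Lap i U)) ∧
      (L2ReadsRel (R := R₀ i) (H := H₀ i) (G₁ i) 0 U (Rel i) (𝔬 i).blk (𝔬 i).blk (ev i) ((𝔬 i).G1 U) ∧
        L2ReadsRel (R := R₀ i) (H := H₀ i) (G₁ i) 1 U (Rel i) (𝔬 i).blkY (𝔬 i).blk (ev i) ((𝔬 i).D U ∘ₗ (𝔬 i).G1 U) ∧
        L2ReadsRel (R := R₀ i) (H := H₀ i) (G₁ i) 2 U (Rel i) (𝔬 i).blk (𝔬 i).blkY (evY i) ((𝔬 i).G1 U ∘ₗ (𝔬 i).Dstar U) ∧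
        L2ReadsRel (R := R₀ i) (H := H₀ i) (G₁ i) 3 U (Rel i) (𝔬 i).blk (𝔬 i).blk (ev i) (Lap i U ∘ₗ (𝔬 i).G1 U) ∧
        L2ReadsRel (R := R₀ i) (H := H₀ i) (G₁ i) 4 U (Rel i) (𝔬 i).blkY (𝔬 i).blkY (evY i)
          ((𝔬 i).D U ∘ₗ ((𝔬 i).G1 U ∘ₗ (𝔬 i).Dstar U)) ∧
        L2ReadsRel (R := R₀ i) (H := H₀ i) (G₁ i) 5 U (Rel i) (𝔬 i).blk (𝔬 i).blk (ev i) ((𝔬 i).G1 U ∘ₗ Lap i U)))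
    (hH1R : ∀ (i : I) (U : (bg i).Cfg),
      H1ReadsRel (GD i) U (𝔭 i) (Rel i) (𝔬 i).blk (𝔬 i).blkY (ev i) (evY i) ((𝔬 i).D U ∘ₗ (𝔬 i).G U)
        ((𝔬 i).G U ∘ₗ (𝔬 i).Dstar U) ∧
      H1ReadsRel (G₁ i) U (𝔭 i) (Rel i) (𝔬 i).blk (𝔬 i).blkY (ev i) (evY i) ((𝔬 i).D U ∘ₗ (𝔬 i).G1 U)
        ((𝔬 i).G1 U ∘ₗ (𝔬 i).Dstar U))
    (hIR : ∀ (i : I) (U : (bg i).Cfg),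
      InputReadsRel (GD i) U (𝔭 i) (bH i) (Rel i) (𝔬 i).blkY (evY i) ((𝔬 i).D U ∘ₗ ((𝔬 i).G U ∘ₗ (𝔬 i).Dstar U)) ∧
      InputReadsRel (G₁ i) U (𝔭 i) (bH i) (Rel i) (𝔬 i).blkY (evY i) ((𝔬 i).D U ∘ₗ ((𝔬 i).G1 U ∘ₗ (𝔬 i).Dstar U)))
    (hsym : ∀ (i : I) (U : (bg i).Cfg), IsTransposePair ((𝔬 i).G U) ((𝔬 i).G U) ∧ IsTransposePair ((𝔬 i).G1 U) ((𝔬 i).G1 U))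
    (htr : ∀ (i : I) (U : (bg i).Cfg),
      IsTransposePair ((𝔬 i).D U ∘ₗ (𝔬 i).G U) ((𝔬 i).G U ∘ₗ (𝔬 i).Dstar U) ∧
      IsTransposePair ((𝔬 i).D U ∘ₗ (𝔬 i).G1 U) ((𝔬 i).G1 U ∘ₗ (𝔬 i).Dstar U))
    (hmodel : ∀ i, M₁ ≤ (geo i).M → ∀ α₀ : ℝ, 0 < α₀ → (geo i).M * α₀ ≤ a₁ →
      ∀ U : (bg i).Cfg, (bg i).Reg335 c35 α₀ U → (bg i).Reg336 c35 α₀ U →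
        Thm33G0 (𝔬 i) (R₀ i) (H₀ i) B₀ δ₀ U ∧
        Step (𝔬 i) (R₀ i) (H₀ i) (hgeo i).lenle 1 (θ₁ * ((geo i).M * α₀)) δK U ∧
        Step (𝔬 i) (R₀ i) (H₀ i) (hgeo i).lenle 2 (θ₁ * ((geo i).M * α₀)) δK U ∧
        FormSmall (𝔬 i) (r₁ * ((geo i).M * α₀)) U ∧ Identities (𝔬 i) U)
    (hleft : ∀ i, M₁ ≤ (geo i).M → ∀ α₀ : ℝ, 0 < α₀ → (geo i).M * α₀ ≤ a₁ →
      ∀ U : (bg i).Cfg, (bg i).Reg335 c35 α₀ U → (bg i).Reg336 c35 α₀ U →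
        LeftStep (𝔬 i) (R₀ i) (H₀ i) (hgeo i).lenle B₀ δ₀ (θD * ((geo i).M * α₀)) δK U)
    (hlettersH : ∀ i, M₁ ≤ (geo i).M → ∀ α₀ : ℝ, 0 < α₀ → (geo i).M * α₀ ≤ a₁ →
      ∀ U : (bg i).Cfg, (bg i).Reg335 c35 α₀ U → (bg i).Reg336 c35 α₀ U →
        LettersH (𝔬 i) (R₀ i) (H₀ i) (hgeo i) B₃ δ₃ U)
    (hG0C : ∀ i, M₁ ≤ (geo i).M → ∀ α₀ : ℝ, 0 < α₀ → (geo i).M * α₀ ≤ a₁ →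
      ∀ U : (bg i).Cfg, (bg i).Reg335 c35 α₀ U → (bg i).Reg336 c35 α₀ U →
        Thm33G0H (𝔬 i) (𝔭 i) (R₀ i) (H₀ i) (bH i) Bh Bi Bi2 δ₀ U ∧ Thm33G0L2 (𝔬 i) (Lap i) (R₀ i) (H₀ i) B₂ δ₀ U)
    (hstepC : ∀ i, M₁ ≤ (geo i).M → ∀ α₀ : ℝ, 0 < α₀ → (geo i).M * α₀ ≤ a₁ →
      ∀ U : (bg i).Cfg, (bg i).Reg335 c35 α₀ U → (bg i).Reg336 c35 α₀ U →
        StepH (𝔬 i) (𝔭 i) (R₀ i) (H₀ i) (bH i) (hgeo i).lenle (θH * ((geo i).M * α₀)) δK U ∧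
        StepL2 (𝔬 i) (R₀ i) (H₀ i) (θ₂ * ((geo i).M * α₀)) δK U)
    (hres : ∀ i, M₁ ≤ (geo i).M → ∀ α₀ : ℝ, 0 < α₀ → (geo i).M * α₀ ≤ a₁ →
      ∀ U : (bg i).Cfg, (bg i).Reg335 c35 α₀ U → (bg i).Reg336 c35 α₀ U →
        ∀ Hk' ∈ [Hk i, H₁k i], ∀ (β : ℝ) (ζ : (geo i).Cut) (y y' : (geo i).Site), 0 ≤ β → β < 1 → (geo i).cutInT ζ y →
          Hk'.h U β ζ y' ≤ Bβ β * (geo i).cutH β ζ * ((geo i).len y) ^ (-(1 + β)) * ((geo i).len y') ^ (-(d : ℝ)) *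
            Real.exp (-(δ₁ / 2 * (geo i).dist y y'))) :
    B9.Thm312Printed d c35 geo bg GD G₁ Hk H₁k (fun i => HasRWExpOfOps (𝔬 i)) (fun i => HasRWExpHOfOps (𝔬 i))
      (fun i => PosDefKOfOps (𝔬 i)) := by
  -- the constants of the leaf
  obtain ⟨MLg, cg, hLg⟩ := hL21 ρ hρ
  set cg' : ℝ := max cg 0 with hcg'
  have hcg'0 : 0 ≤ cg' := le_max_right _ _
  set a₀ : ℝ := min a₁ (min (2 * (θ₁ * c + 1))⁻¹ (min (2 * (r₁ + 1))⁻¹ (2 * (B₂ * θ₂ * c * c + 1))⁻¹)) with ha₀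
  set BL : ℝ := B₀ + θD * a₁ * (2 * B₀) * c with hBL
  set Bsup : ℝ := max (2 * B₀) BL with hBsup
  set BsupR : ℝ := (m : ℝ) * Bsup with hBsupR
  set Bgl : ℝ := Bsup * cg' * Lc ^ (4 : ℝ) with hBgl
  set BH : ℝ := max (2 * (B₃ * B₃ * c)) (B₃ * B₃ * c + θD * a₁ * (2 * (B₃ * B₃ * c)) * c) with hBH
  set CH : ℝ := BH * Lc ^ (2 : ℝ) with hCH
  set Λu : ℝ := Lc ^ (4 : ℝ) with hΛu
  set tH : ℝ := θH * a₁ with htH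
  set KLu : ℝ := 2 * B₀ * Λu + (B₀ + θD * a₁ * (2 * B₀) * c + 2 * B₀) * Λu +
    (B₂ + B₂ * (θ₂ * a₁ * (2 * B₂) * c) * c) * (1 + Λu + Λu) with hKLu
  set BL2 : ℝ := (m : ℝ) * m * KLu with hBL2
  set Bout : ℝ := max (max (max (max BsupR Bgl) CH) BL2) 1 with hBout
  set δout : ℝ := min ρf δ₁ with hδout
  -- the output Hölder constants
  set Bβo : ℝ → ℝ := fun β => max ((m : ℝ) * (Bh β + tH * (2 * B₀) * c)) (Bβ β) with hBβo
  set Bεo : ℝ → ℝ := fun ε => Bi ε + BL * Λu * tH * c with hBεo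
  set Bεβo : ℝ → ℝ → ℝ := fun ε β => Bi2 ε β + (Bh β + tH * (2 * B₀) * c) * Λu * tH * c with hBεβo
  have hθc : 0 ≤ θ₁ * c := mul_nonneg hθ₁ hc
  have hB₂c : 0 ≤ B₂ * θ₂ * c * c := mul_nonneg (mul_nonneg (mul_nonneg hB₂ hθ₂) hc) hc
  have ha₀pos : 0 < a₀ :=
    lt_min ha₁ (lt_min (inv_pos.mpr (by linarith)) (lt_min (inv_pos.mpr (by linarith)) (inv_pos.mpr (by linarith))))
  have hBsup2 : 2 * B₀ ≤ Bsup := le_max_left _ _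
  have hBsupL : BL ≤ Bsup := le_max_right _ _
  have hBsup0 : 0 ≤ Bsup := le_trans (by linarith) hBsup2
  have hBsupR0 : 0 ≤ BsupR := mul_nonneg (Nat.cast_nonneg m) hBsup0
  have hB33 : 0 ≤ B₃ * B₃ * c := mul_nonneg (mul_nonneg hB₃ hB₃) hc
  have hBH2 : 2 * (B₃ * B₃ * c) ≤ BH := le_max_left _ _
  have hBHL : B₃ * B₃ * c + θD * a₁ * (2 * (B₃ * B₃ * c)) * c ≤ BH := le_max_right _ _
  have hBH0 : 0 ≤ BH := le_trans (by linarith) hBH2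
  have hBoutS : BsupR ≤ Bout := (((le_max_left _ _).trans (le_max_left _ _)).trans (le_max_left _ _)).trans (le_max_left _ _)
  have hBoutG : Bgl ≤ Bout := (((le_max_right _ _).trans (le_max_left _ _)).trans (le_max_left _ _)).trans (le_max_left _ _)
  have hBoutH : CH ≤ Bout := ((le_max_right _ _).trans (le_max_left _ _)).trans (le_max_left _ _)
  have hBoutL : BL2 ≤ Bout := (le_max_right _ _).trans (le_max_left _ _)
  have hBout0 : 0 ≤ Bout := zero_le_one.trans (le_max_right _ _)
  have hδρf : δout ≤ ρf := min_le_left _ _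
  have hδδ₁ : δout ≤ δ₁ := min_le_right _ _
  have hαρ : 0 ≤ α * ρ := mul_nonneg hα0 hρ.le
  have hρf_le : ρf ≤ ρ := by linarith
  have hδρ : δout ≤ ρ := hδρf.trans hρf_le
  have hτ : δout ≤ 2 * ((1 - α) * ρ) := by
    have h1 : 0 ≤ (1 - 2 * α) * ρ := mul_nonneg (by linarith) hρ.le
    have h2 : 2 * ((1 - α) * ρ) = ρ + (1 - 2 * α) * ρ := by ring
    rw [h2]
    linarith
  have htH0 : 0 ≤ tH := mul_nonneg hθH ha₁.le
  have hBL0 : 0 ≤ BL := add_nonneg hB₀ (mul_nonneg (mul_nonneg (mul_nonneg hθD ha₁.le) (by linarith)) hc)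
  have hBβo0 : ∀ β, 0 ≤ Bβo β := fun β => (hBβ β).trans (le_max_right _ _)
  refine ⟨max (max M₁ ML) MLg, δout, a₀, Bout, Bβo, Bεo, Bεβo, lt_max_of_lt_left (lt_max_of_lt_left hM₁), lt_min hρf hδ₁,
    ha₀pos, zero_lt_one.trans_le (le_max_right _ _), ?_⟩
  intro i hM α₀ hα₀ hMa U hU hU'
  have hM₁i : M₁ ≤ (geo i).M := ((le_max_left _ _).trans (le_max_left _ _)).trans hM
  have hMLi : ML ≤ (geo i).M := ((le_max_right _ _).trans (le_max_left _ _)).trans hM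
  have hMLgi : MLg ≤ (geo i).M := (le_max_right _ _).trans hM
  have hMpos : 0 < (geo i).M := hM₁.trans_le hM₁i
  have hm0 : 0 ≤ (geo i).M * α₀ := (mul_pos hMpos hα₀).le
  have hma₁ : (geo i).M * α₀ ≤ a₁ := hMa.trans (min_le_left _ _)
  have hmθ : (geo i).M * α₀ ≤ (2 * (θ₁ * c + 1))⁻¹ := hMa.trans ((min_le_right _ _).trans (min_le_left _ _))
  have hmr : (geo i).M * α₀ ≤ (2 * (r₁ + 1))⁻¹ := hMa.trans ((min_le_right _ _).trans ((min_le_right _ _).trans (min_le_left _ _)))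
  have hm₂ : (geo i).M * α₀ ≤ (2 * (B₂ * θ₂ * c * c + 1))⁻¹ :=
    hMa.trans ((min_le_right _ _).trans ((min_le_right _ _).trans (min_le_right _ _)))
  obtain ⟨h33, hS1, hS2, hF, hI⟩ := hmodel i hM₁i α₀ hα₀ hma₁ U hU hU'
  have hLS := hleft i hM₁i α₀ hα₀ hma₁ U hU hU'
  have hLH := hlettersH i hM₁i α₀ hα₀ hma₁ U hU hU'
  obtain ⟨hH0, hL2s⟩ := hG0C i hM₁i α₀ hα₀ hma₁ U hU hU'
  obtain ⟨hStH, hStL⟩ := hstepC i hM₁i α₀ hα₀ hma₁ U hU hU'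
  have hresH := hres i hM₁i α₀ hα₀ hma₁ U hU hU'
  have hrowi := hrow i hMLi
  obtain ⟨h260, hrowg, hsize⟩ := hLg i hMLgi
  have hrowg' : RowSum (toB6 (geo i) (R₀ i) (H₀ i)) ((1 - α) * ρ) cg' := fun y => (hrowg y).trans (le_max_left _ _)
  set θ : ℝ := θ₁ * ((geo i).M * α₀) with hθdef
  set θ' : ℝ := θD * ((geo i).M * α₀) with hθ'def
  set θH' : ℝ := θH * ((geo i).M * α₀) with hθH'def
  set θ₂' : ℝ := θ₂ * ((geo i).M * α₀) with hθ₂'def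
  have hθ : 0 ≤ θ := mul_nonneg hθ₁ hm0
  have hθ' : 0 ≤ θ' := mul_nonneg hθD hm0
  have hθH' : 0 ≤ θH' := mul_nonneg hθH hm0
  have hθ₂' : 0 ≤ θ₂' := mul_nonneg hθ₂ hm0
  have hq : θ * c ≤ 1 / 2 := by
    have h := small_aux₄ (mul_nonneg hθ₁ hc) hmθ
    calc θ * c = θ₁ * c * ((geo i).M * α₀) := by rw [hθdef]; ring
      _ ≤ 1 / 2 := h
  have hq1 : θ * c < 1 := lt_one_of_le_half hq
  have hq₂ : B₂ * θ₂' * c * c ≤ 1 / 2 := by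
    have h := small_aux₄ hB₂c hm₂
    calc B₂ * θ₂' * c * c = B₂ * θ₂ * c * c * ((geo i).M * α₀) := by rw [hθ₂'def]; ring
      _ ≤ 1 / 2 := h
  have hq₂1 : B₂ * θ₂' * c * c < 1 := lt_one_of_le_half hq₂
  have hr : r₁ * ((geo i).M * α₀) < 1 := by
    have h := small_aux₄ hr₁ hmr
    linarith
  have hσδ : σ ≤ δK := (le_add_of_nonneg_left hρ.le).trans hρδ
  have hinv0 : 0 ≤ (1 - θ * c)⁻¹ := inv_nonneg.mpr (sub_nonneg.mpr hq1.le)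
  have hinv2 : (1 - θ * c)⁻¹ ≤ 2 := inv_one_sub_le_two hq
  have hC0 : 0 ≤ B₀ * (1 - θ * c)⁻¹ := mul_nonneg hB₀ hinv0
  have hCle : B₀ * (1 - θ * c)⁻¹ ≤ Bsup := (const_le_two_mul hB₀ hq).trans hBsup2
  have hθ'le : θ' ≤ θD * a₁ := mul_le_mul_of_nonneg_left hma₁ hθD
  have hθH'le : θH' ≤ tH := mul_le_mul_of_nonneg_left hma₁ hθH
  have hθ₂'le : θ₂' ≤ θ₂ * a₁ := mul_le_mul_of_nonneg_left hma₁ hθ₂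
  have hC1 : 0 ≤ B₀ + θ' * (B₀ * (1 - θ * c)⁻¹) * c := add_nonneg hB₀ (mul_nonneg (mul_nonneg hθ' hC0) hc)
  have hC1L : B₀ + θ' * (B₀ * (1 - θ * c)⁻¹) * c ≤ BL := by
    have h2 : θ' * (B₀ * (1 - θ * c)⁻¹) ≤ θD * a₁ * (2 * B₀) :=
      mul_le_mul hθ'le (const_le_two_mul hB₀ hq) hC0 (mul_nonneg hθD ha₁.le)
    have h3 : θ' * (B₀ * (1 - θ * c)⁻¹) * c ≤ θD * a₁ * (2 * B₀) * c := mul_le_mul_of_nonneg_right h2 hc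
    rw [hBL]; linarith
  have hC1le : B₀ + θ' * (B₀ * (1 - θ * c)⁻¹) * c ≤ Bsup := hC1L.trans hBsupL
  have hfix := fix_of_inverses hI.invG0' hI.invG
  have hfix1 := fix_of_inverses hI.invG0' hI.invG1
  obtain ⟨hcoG0, hcoG2, hcoG10, hcoG12⟩ := hcoR i U
  obtain ⟨hcoG1, hcoG11⟩ := hco1R i U
  obtain ⟨hcH0, hcH1, hcH10, hcH11⟩ := hcoHR i U
  obtain ⟨hgD0, hgD1, hgD2, hg10, hg11, hg12⟩ := hcoG i U
  obtain ⟨⟨hlD0, hlD1, hlD2, hlD3, hlD4, hlD5⟩, ⟨hl10, hl11, hl12, hl13, hl14, hl15⟩⟩ := hl2R i U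
  obtain ⟨hH1D, hH11⟩ := hH1R i U
  obtain ⟨hIRD, hIR1⟩ := hIR i U
  obtain ⟨hsymG, hsymG1⟩ := hsym i U
  obtain ⟨htrG, htrG1⟩ := htr i U
  have hlen := (hgeo i).lenle
  -- the scale transfers of p. 398 at (ρ, α) and the uniform bound of their constants
  have hL0i : 0 < (geo i).L := lt_of_lt_of_le one_pos (hL1 i)
  have hLc1 : 1 ≤ Lc := (hL1 i).trans (hLle i)
  have hL4 : (geo i).L ^ (4 : ℝ) ≤ Λu := Real.rpow_le_rpow hL0i.le (hLle i) (by norm_num)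
  have hΛu0 : 0 ≤ Λu := Real.rpow_nonneg (hL0i.le.trans (hLle i)) _
  have hST : ∀ γ : ℝ, |γ| ≤ 4 → ScaleTransfer (geo i) ρ α ((geo i).L ^ |γ|) (fun y => (geo i).len y ^ γ) ∧
      0 ≤ (geo i).L ^ |γ| ∧ (geo i).L ^ |γ| ≤ Λu := fun γ hγ =>
    ⟨scaleTransfer_rpow_of_260 h260 hsize (hL1 i) (hη i) γ hγ, Real.rpow_nonneg hL0i.le _,
      (B9Ineq347AllEntries.size_condition_compact (geo i).L γ _ (hL1 i) hγ hsize).2.trans hL4⟩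
  obtain ⟨hST1, hΛ₁0, hΛ₁le⟩ := hST 1 (by norm_num)
  obtain ⟨hSTh, hΛh0, hΛhle⟩ := hST (1 / 2) (by rw [abs_of_nonneg (by norm_num : (0 : ℝ) ≤ 1 / 2)]; norm_num)
  obtain ⟨hSTm, hΛm0, hΛmle⟩ := hST (-1) (by norm_num)
  -- the model majorants at the rate ρ
  have hm0 := entry0_of_step (hgeo i) hrowi hθ hB₀ hρ.le hρS hρδ hS2.step h33.e0 hfix hq1
  have hm1 := entry1_of_stepD (hgeo i) hrowi hθ hθ' hB₀ hρ.le hρS hρδ hS2.step hLS.stepD h33.e0 hLS.e1 hfix hq1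
  have hm2 := entry2_of_step (hgeo i) hrowi hθ hB₀ hρ.le hρS hρδ hS1.step h33.e2 hfix hq1
  have hm10 := entry0_of_step (hgeo i) hrowi hθ hB₀ hρ.le hρS hρδ hS2.step1 h33.e0 hfix1 hq1
  have hm11 := entry1_of_stepD (hgeo i) hrowi hθ hθ' hB₀ hρ.le hρS hρδ hS2.step1 hLS.stepD1 h33.e0 hLS.e1 hfix1 hq1
  have hm12 := entry2_of_step (hgeo i) hrowi hθ hB₀ hρ.le hρS hρδ hS1.step1 h33.e2 hfix1 hq1
  -- the same majorants in the `maj342 · n Bsup ρ` shape, for the (3.47) passage on the model lattice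
  have hM0 : HasMajorantHom (g := toB6 (geo i) (R₀ i) (H₀ i)) (𝔬 i).blk (𝔬 i).blk ((𝔬 i).G U) (maj342 (geo i) 0 Bsup ρ) :=
    hasMajorantHom_maj342_zero_of_le ((hasMajorantHom_iff (g := toB6 (geo i) (R₀ i) (H₀ i)) (𝔬 i).blk _ _).2 hm0) hCle
  have hM1 : HasMajorantHom (g := toB6 (geo i) (R₀ i) (H₀ i)) (𝔬 i).blk (𝔬 i).blkY ((𝔬 i).D U ∘ₗ (𝔬 i).G U) (maj342 (geo i) 1 Bsup ρ) :=
    hasMajorantHom_maj342_one_of_le hm1 hC1le hlen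
  have hM2 : HasMajorantHom (g := toB6 (geo i) (R₀ i) (H₀ i)) (𝔬 i).blkY (𝔬 i).blk ((𝔬 i).G U ∘ₗ (𝔬 i).Dstar U) (maj342 (geo i) 2 Bsup ρ) :=
    hasMajorantHom_maj342_two_of_le hm2 hCle hlen
  have hM10 : HasMajorantHom (g := toB6 (geo i) (R₀ i) (H₀ i)) (𝔬 i).blk (𝔬 i).blk ((𝔬 i).G1 U) (maj342 (geo i) 0 Bsup ρ) :=
    hasMajorantHom_maj342_zero_of_le ((hasMajorantHom_iff (g := toB6 (geo i) (R₀ i) (H₀ i)) (𝔬 i).blk _ _).2 hm10) hCle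
  have hM11 : HasMajorantHom (g := toB6 (geo i) (R₀ i) (H₀ i)) (𝔬 i).blk (𝔬 i).blkY ((𝔬 i).D U ∘ₗ (𝔬 i).G1 U) (maj342 (geo i) 1 Bsup ρ) :=
    hasMajorantHom_maj342_one_of_le hm11 hC1le hlen
  have hM12 : HasMajorantHom (g := toB6 (geo i) (R₀ i) (H₀ i)) (𝔬 i).blkY (𝔬 i).blk ((𝔬 i).G1 U ∘ₗ (𝔬 i).Dstar U) (maj342 (geo i) 2 Bsup ρ) :=
    hasMajorantHom_maj342_two_of_le hm12 hCle hlen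
  -- the proved clauses (3.42)₁,₂,₃ at the rate ρ with the constant m·Bsup, through the RELATIVE co-readings
  have clG0 : Clause342 (GD i) 0 BsupR ρ U :=
    clause342_of_hasMajorantHom_rel hcoG0 hBsup0 hlen (hsat i 0 Bsup ρ).1 (hsat i 0 Bsup ρ).2 (hmult i) hM0
  have clG1 : Clause342 (GD i) 1 BsupR ρ U :=
    clause342_of_hasMajorantHom_rel hcoG1 hBsup0 hlen (hsat i 1 Bsup ρ).1 (hsat i 1 Bsup ρ).2 (hmult i) hM1
  have clG2 : Clause342 (GD i) 2 BsupR ρ U :=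
    clause342_of_hasMajorantHom_rel hcoG2 hBsup0 hlen (hsat i 2 Bsup ρ).1 (hsat i 2 Bsup ρ).2 (hmult i) hM2
  have clG10 : Clause342 (G₁ i) 0 BsupR ρ U :=
    clause342_of_hasMajorantHom_rel hcoG10 hBsup0 hlen (hsat i 0 Bsup ρ).1 (hsat i 0 Bsup ρ).2 (hmult i) hM10
  have clG11 : Clause342 (G₁ i) 1 BsupR ρ U :=
    clause342_of_hasMajorantHom_rel hcoG11 hBsup0 hlen (hsat i 1 Bsup ρ).1 (hsat i 1 Bsup ρ).2 (hmult i) hM11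
  have clG12 : Clause342 (G₁ i) 2 BsupR ρ U :=
    clause342_of_hasMajorantHom_rel hcoG12 hBsup0 hlen (hsat i 2 Bsup ρ).1 (hsat i 2 Bsup ρ).2 (hmult i) hM12
  -- the global entries (3.47)₀,₁,₂
  have hL4' : (geo i).L ^ (4 : ℝ) ≤ Lc ^ (4 : ℝ) := hL4
  have hCgl0 : 0 ≤ Bsup * cg' * (geo i).L ^ (4 : ℝ) := mul_nonneg (mul_nonneg hBsup0 hcg'0) (Real.rpow_nonneg hL0i.le _)
  have hCglle : Bsup * cg' * (geo i).L ^ (4 : ℝ) ≤ Bout :=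
    (mul_le_mul_of_nonneg_left hL4' (mul_nonneg hBsup0 hcg'0)).trans hBoutG
  have globK : ∀ {K : B9.KernelFamily (geo i) (bg i)} {u₀ v₀ u₁ v₁ u₂ v₂ : Type} {bu₀ : u₀ → (geo i).Site} {bv₀ : v₀ → (geo i).Site}
      {ev₀ : (geo i).Loc → v₀ → ℝ} {A₀ : (v₀ → ℝ) →ₗ[ℝ] (u₀ → ℝ)} {bu₁ : u₁ → (geo i).Site} {bv₁ : v₁ → (geo i).Site}
      {ev₁ : (geo i).Loc → v₁ → ℝ} {A₁ : (v₁ → ℝ) →ₗ[ℝ] (u₁ → ℝ)} {bu₂ : u₂ → (geo i).Site} {bv₂ : v₂ → (geo i).Site}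
      {ev₂ : (geo i).Loc → v₂ → ℝ} {A₂ : (v₂ → ℝ) →ₗ[ℝ] (u₂ → ℝ)},
      CoReadsGlob K 0 U bu₀ bv₀ ev₀ A₀ → HasMajorantHom (g := toB6 (geo i) (R₀ i) (H₀ i)) bv₀ bu₀ A₀ (maj342 (geo i) 0 Bsup ρ) →
      CoReadsGlob K 1 U bu₁ bv₁ ev₁ A₁ → HasMajorantHom (g := toB6 (geo i) (R₀ i) (H₀ i)) bv₁ bu₁ A₁ (maj342 (geo i) 1 Bsup ρ) →
      CoReadsGlob K 2 U bu₂ bv₂ ev₂ A₂ → HasMajorantHom (g := toB6 (geo i) (R₀ i) (H₀ i)) bv₂ bu₂ A₂ (maj342 (geo i) 2 Bsup ρ) →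
      ∀ (n : Fin 4) (lam : (geo i).Loc) (γ : ℝ), n ≠ 3 → -4 ≤ γ → γ ≤ 4 →
        K.glob n U lam γ ≤ Bout * (geo i).wNorm γ lam := fun hc0 hA0 hc1 hA1 hc2 hA2 =>
    glob_noLap_of_entries (PG := fun _ => True) (S i) hCgl0 hCgl0 hCgl0 hCglle hCglle hCglle
      (fun lam γ _ => glob_of_hasMajorantHom hc0 hA0 hBsup0 hcg'0 (hL1 i) (hη i) (S i).wNorm_nonneg hsize h260 hrowg' lam γ)
      (fun lam γ _ => glob_of_hasMajorantHom hc1 hA1 hBsup0 hcg'0 (hL1 i) (hη i) (S i).wNorm_nonneg hsize h260 hrowg' lam γ)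
      (fun lam γ _ => glob_of_hasMajorantHom hc2 hA2 hBsup0 hcg'0 (hL1 i) (hη i) (S i).wNorm_nonneg hsize h260 hrowg' lam γ)
      (fun _ _ _ h => absurd trivial h)
  -- the uniform bounds of the member constants of the two blocks
  have hm00 : (0 : ℝ) ≤ m := Nat.cast_nonneg m
  have hKL : constL2 B₀ θ θ' B₂ θ₂' c ((geo i).L ^ |(1 : ℝ)|) ((geo i).L ^ |(1 / 2 : ℝ)|) ((geo i).L ^ |(-1 : ℝ)|) ≤ KLu :=
    constL2_le hB₀ hB₂ hc hθ' hθ'le hθ₂' hθ₂'le hq hq₂ hΛ₁0 hΛ₁le hΛh0 hΛhle hΛm0 hΛmle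
  have hKL2 : (m : ℝ) * m * constL2 B₀ θ θ' B₂ θ₂' c ((geo i).L ^ |(1 : ℝ)|) ((geo i).L ^ |(1 / 2 : ℝ)|) ((geo i).L ^ |(-1 : ℝ)|) ≤
      Bout := (mul_le_mul_of_nonneg_left hKL (mul_nonneg hm00 hm00)).trans hBoutL
  have hBhA : ∀ β, Bh β + θH' * (B₀ * (1 - θ * c)⁻¹) * c ≤ Bh β + tH * (2 * B₀) * c := fun β => by
    have h := mul_le_mul_of_nonneg_right (mul_le_mul hθH'le (const_le_two_mul hB₀ hq) hC0 htH0) hc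
    linarith
  have hβo : ∀ β, 0 ≤ β → β < 1 → (m : ℝ) * (Bh β + θH' * (B₀ * (1 - θ * c)⁻¹) * c) ≤ Bβo β ∧ 0 ≤ Bβo β := fun β _ _ =>
    ⟨(mul_le_mul_of_nonneg_left (hBhA β) hm00).trans (le_max_left _ _), hBβo0 β⟩
  have hεo : ∀ ε, 0 < ε → ε ≤ 1 →
      Bi ε + (B₀ + θ' * (B₀ * (1 - θ * c)⁻¹) * c) * (geo i).L ^ |(1 : ℝ)| * θH' * c ≤ Bεo ε ∧ 0 ≤ Bεo ε := by
    intro ε h0 h1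
    have h : (B₀ + θ' * (B₀ * (1 - θ * c)⁻¹) * c) * (geo i).L ^ |(1 : ℝ)| * θH' * c ≤ BL * Λu * tH * c :=
      mul_le_mul_of_nonneg_right (mul_le_mul (mul_le_mul hC1L hΛ₁le hΛ₁0 hBL0) hθH'le hθH' (mul_nonneg hBL0 hΛu0)) hc
    exact ⟨by simp only [hBεo]; linarith,
      add_nonneg (hBi ε h0 h1) (mul_nonneg (mul_nonneg (mul_nonneg hBL0 hΛu0) htH0) hc)⟩
  have hεβo : ∀ ε β, 0 < ε → ε ≤ 1 → 0 ≤ β → β < 1 →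
      Bi2 ε β + (Bh β + θH' * (B₀ * (1 - θ * c)⁻¹) * c) * (geo i).L ^ |(1 : ℝ)| * θH' * c ≤ Bεβo ε β ∧ 0 ≤ Bεβo ε β := by
    intro ε β hε0 hε1 h0 h1
    have hA0 : 0 ≤ Bh β + θH' * (B₀ * (1 - θ * c)⁻¹) * c := add_nonneg (hBh β h0 h1) (mul_nonneg (mul_nonneg hθH' hC0) hc)
    have hA1 : 0 ≤ Bh β + tH * (2 * B₀) * c := hA0.trans (hBhA β)
    have h : (Bh β + θH' * (B₀ * (1 - θ * c)⁻¹) * c) * (geo i).L ^ |(1 : ℝ)| * θH' * c ≤ (Bh β + tH * (2 * B₀) * c) * Λu * tH * c :=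
      mul_le_mul_of_nonneg_right (mul_le_mul (mul_le_mul (hBhA β) hΛ₁le hΛ₁0 hA1) hθH'le hθH' (mul_nonneg hA1 hΛu0)) hc
    exact ⟨by simp only [hBεβo]; linarith,
      add_nonneg (hBi2 ε β hε0 hε1 h0 h1) (mul_nonneg (mul_nonneg (mul_nonneg hA1 hΛu0) htH0) hc)⟩
  -- the two blocks of G_D and G₁, proved inside, and the rest of each K-leaf
  have resK : ∀ (K : B9.KernelFamily (geo i) (bg i)) (A T : Module.End ℝ (X i → ℝ)), ((𝔬 i).S0 U - T) * A = 1 →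
      Clause342 K 0 BsupR ρ U → Clause342 K 1 BsupR ρ U → Clause342 K 2 BsupR ρ U →
      (∀ (n : Fin 4) (lam : (geo i).Loc) (γ : ℝ), n ≠ 3 → -4 ≤ γ → γ ≤ 4 → K.glob n U lam γ ≤ Bout * (geo i).wNorm γ lam) →
      HasMaj (cNorm (R₀ i) (H₀ i) (𝔬 i).blk (hgeo i).lenle 1) (cNorm (R₀ i) (H₀ i) (𝔬 i).blk (hgeo i).lenle 1) ((𝔬 i).G0 U ∘ₗ T)
        (fun a b => θ * Real.exp (-(δK * (geo i).dist a b))) →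
      HasMaj (cNorm (R₀ i) (H₀ i) (𝔬 i).blk (hgeo i).lenle 2) (cNorm (R₀ i) (H₀ i) (𝔬 i).blk (hgeo i).lenle 2) ((𝔬 i).G0 U ∘ₗ T)
        (fun a b => θ * Real.exp (-(δK * (geo i).dist a b))) →
      HasMaj (cNorm (R₀ i) (H₀ i) (𝔬 i).blk (hgeo i).lenle 2) (cNorm (R₀ i) (H₀ i) (𝔬 i).blkY (hgeo i).lenle 1)
        ((𝔬 i).D U ∘ₗ (𝔬 i).G0 U ∘ₗ T) (fun a b => θ' * Real.exp (-(δK * (geo i).dist a b))) →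
      (∀ β : ℝ, 0 ≤ β → β < 1 → HasMaj (cNormR (R₀ i) (H₀ i) (𝔬 i).blk (hgeo i).lenle (-2))
        (cNormR (R₀ i) (H₀ i) (𝔭 i).blkPY (hgeo i).lenle (β - 1)) (((𝔭 i).ΦY U β ∘ₗ (𝔬 i).D U ∘ₗ (𝔬 i).G0 U) ∘ₗ T)
        (fun a b => θH' * Real.exp (-(δK * (geo i).dist a b)))) →
      (∀ β : ℝ, 0 ≤ β → β < 1 → HasMaj (cNormR (R₀ i) (H₀ i) (𝔬 i).blk (hgeo i).lenle (-1))
        (cNormR (R₀ i) (H₀ i) (𝔭 i).blkPX (hgeo i).lenle (β - 1)) (((𝔭 i).ΦX U β ∘ₗ (𝔬 i).G0 U) ∘ₗ T)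
        (fun a b => θH' * Real.exp (-(δK * (geo i).dist a b)))) →
      (∀ ε : ℝ, 0 < ε → HasMaj (bH i ε) (cNormR (R₀ i) (H₀ i) (𝔬 i).blk (hgeo i).lenle 1) (T ∘ₗ ((𝔬 i).G0 U ∘ₗ (𝔬 i).Dstar U))
        (fun a b => θH' * Real.exp (-(δK * (geo i).dist a b)))) →
      BlockBd (g := toB6 (geo i) (R₀ i) (H₀ i)) (𝔬 i).blk (𝔬 i).blk T
        (fun (y y' : (geo i).Site) => θ₂' * ((geo i).len y)⁻¹ * ((geo i).len y')⁻¹ * Real.exp (-(δK * (geo i).dist y y'))) →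
      IsTransposePair A A → IsTransposePair ((𝔬 i).D U ∘ₗ A) (A ∘ₗ (𝔬 i).Dstar U) →
      L2ReadsRel (R := R₀ i) (H := H₀ i) K 0 U (Rel i) (𝔬 i).blk (𝔬 i).blk (ev i) A →
      L2ReadsRel (R := R₀ i) (H := H₀ i) K 1 U (Rel i) (𝔬 i).blkY (𝔬 i).blk (ev i) ((𝔬 i).D U ∘ₗ A) →
      L2ReadsRel (R := R₀ i) (H := H₀ i) K 2 U (Rel i) (𝔬 i).blk (𝔬 i).blkY (evY i) (A ∘ₗ (𝔬 i).Dstar U) →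
      L2ReadsRel (R := R₀ i) (H := H₀ i) K 3 U (Rel i) (𝔬 i).blk (𝔬 i).blk (ev i) (Lap i U ∘ₗ A) →
      L2ReadsRel (R := R₀ i) (H := H₀ i) K 4 U (Rel i) (𝔬 i).blkY (𝔬 i).blkY (evY i) ((𝔬 i).D U ∘ₗ (A ∘ₗ (𝔬 i).Dstar U)) →
      L2ReadsRel (R := R₀ i) (H := H₀ i) K 5 U (Rel i) (𝔬 i).blk (𝔬 i).blk (ev i) (A ∘ₗ Lap i U) →
      H1ReadsRel K U (𝔭 i) (Rel i) (𝔬 i).blk (𝔬 i).blkY (ev i) (evY i) ((𝔬 i).D U ∘ₗ A) (A ∘ₗ (𝔬 i).Dstar U) →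
      InputReadsRel K U (𝔭 i) (bH i) (Rel i) (𝔬 i).blkY (evY i) ((𝔬 i).D U ∘ₗ (A ∘ₗ (𝔬 i).Dstar U)) →
      B9.Ineq342_346_347_noLap K Bout δout U ∧ B9.Ineq343_345 K Bβo Bεo Bεβo δout U ∧
        HasRWExpOfOps (𝔬 i) K U δout ∧ PosDefKOfOps (𝔬 i) K U := by
    intro K A T hIA c0 c1 c2 hgl hK1 hK2 hKD hpY hpX htD hT2 hsymA htrA hl0 hl1 hl2 hl3 hl4 hl5 hH1 hIRA
    have hl2B := l2Block_of_step (hgeo i) (𝔬 i) (Lap i) (Rel i) (ev i) (evY i) hrowi hθ hθ' hθ₂' hB₀ hB₂ hσ hα0 hρ.le hρS hρδ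
      hq1 hq₂1 hρf.le hρf1 hρf2 hΛ₁0 hΛh0 hΛm0 hST1 hSTh hSTm hI.invG0' hIA h33.e0 hLS.e1 h33.e2 hL2s hK1 hK2 hKD hT2 hsymA
      htrA (hRlen i) (hRdist i) (hRdist' i) (hmult i) hl0 hl1 hl2 hl3 hl4 hl5
    have hHo := holder_of_step (hgeo i) (𝔬 i) (𝔭 i) (bH i) (Rel i) (ev i) (evY i) hrowi hθ hθ' hθH' hB₀ hσ hα0 hρ.le hρS hρδ
      hq1 hρf.le hρf1 hΛ₁0 hBh hBi hBi2 hST1 hI.invG0' hIA h33.e0 hLS.e1 h33.e2 hH0 hK1 hK2 hKD hpY hpX htD (hRlen i) (hRdist i)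
      (hRdist' i) (hmult i) hH1 hIRA
    have w : ∀ {j : Fin 4}, Clause342 K j BsupR ρ U → Clause342 K j Bout δout U := fun cm =>
      clause342_mono cm hBsupR0 hBoutS hδρ (S i).dist_nonneg hlen (S i).supNorm_nonneg
    exact ⟨⟨eNoLap_of_clauses (w c0) (w c1) (w c2), l2Block_mono (S i) hl2B hKL2 hBout0 hδρf, hgl⟩,
      ineq343_345_mono_on (S i) hHo (hgeo i).lenpos hβo hεo hεβo hδρf,
      hasRWExp_of_schemas (hgeo i) hrowi hθ hσδ hq1 hS2 hI K δout, posDefK_of_schemas hr hF hI K⟩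
  -- (3.133): H = G∘(Q*C), ∇H, H₁, ∇H₁ as entries; the class ratio transferred by (2.60) at (ρ, α); the co-readings
  have hST2 : B9Ineq347.ScaleTransfer (geo i) ρ α (Lc ^ (2 : ℝ)) (fun y => (geo i).len y ^ (2 : ℝ)) := by
    obtain ⟨h2, _, _⟩ := hST 2 (by norm_num)
    have hΛle : (geo i).L ^ |(2 : ℝ)| ≤ Lc ^ (2 : ℝ) := by
      rw [abs_of_pos (by norm_num : (0 : ℝ) < 2)]
      exact Real.rpow_le_rpow hL0i.le (hLle i) (by norm_num)
    exact fun y y' => (h2 y y').trans (mul_le_mul_of_nonneg_right hΛle (B9Ineq347AllEntries.weight_nonneg (geo i) hL0i (hη i) 2 y))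
  have hLc2 : 0 ≤ Lc ^ (2 : ℝ) := Real.rpow_nonneg (hL0i.le.trans (hLle i)) _
  -- the entry constants and their uniform bounds
  have hKH0 : 0 ≤ B₃ * B₃ * c * (1 - θ * c)⁻¹ := mul_nonneg hB33 hinv0
  have hKH0le : B₃ * B₃ * c * (1 - θ * c)⁻¹ ≤ BH := by
    have h1 : B₃ * B₃ * c * (1 - θ * c)⁻¹ ≤ B₃ * B₃ * c * 2 := mul_le_mul_of_nonneg_left hinv2 hB33
    linarith
  have hKH1 : 0 ≤ B₃ * B₃ * c + θ' * (B₃ * B₃ * c * (1 - θ * c)⁻¹) * c := add_nonneg hB33 (mul_nonneg (mul_nonneg hθ' hKH0) hc)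
  have hKH1le : B₃ * B₃ * c + θ' * (B₃ * B₃ * c * (1 - θ * c)⁻¹) * c ≤ BH := by
    have h1 : B₃ * B₃ * c * (1 - θ * c)⁻¹ ≤ 2 * (B₃ * B₃ * c) := by
      have := mul_le_mul_of_nonneg_left hinv2 hB33; linarith
    have h2 : θ' * (B₃ * B₃ * c * (1 - θ * c)⁻¹) ≤ θD * a₁ * (2 * (B₃ * B₃ * c)) :=
      mul_le_mul hθ'le h1 hKH0 (mul_nonneg hθD ha₁.le)
    have h3 : θ' * (B₃ * B₃ * c * (1 - θ * c)⁻¹) * c ≤ θD * a₁ * (2 * (B₃ * B₃ * c)) * c := mul_le_mul_of_nonneg_right h2 hc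
    linarith
  have hCHle : ∀ {K : ℝ}, K ≤ BH → K * Lc ^ (2 : ℝ) ≤ Bout := fun hK =>
    (mul_le_mul_of_nonneg_right hK hLc2).trans hBoutH
  have resH : ∀ (Hk' : B9.HKernel (geo i) (bg i)) (Hop : (Z i → ℝ) →ₗ[ℝ] (X i → ℝ)), Hk' ∈ [Hk i, H₁k i] →
      CoRealizesHRel Hk' 0 U d (Rel i) (𝔬 i).blk (𝔬 i).blkZ Hop → CoRealizesHRel Hk' 1 U d (Rel i) (𝔬 i).blkY (𝔬 i).blkZ ((𝔬 i).D U ∘ₗ Hop) →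
      HasMaj (cNorm (R₀ i) (H₀ i) (𝔬 i).blkZ (hgeo i).lenle 2) (cNorm (R₀ i) (H₀ i) (𝔬 i).blk (hgeo i).lenle 2) Hop
        (fun a b => B₃ * B₃ * c * (1 - θ * c)⁻¹ * Real.exp (-(ρ * (geo i).dist a b))) →
      HasMaj (cNorm (R₀ i) (H₀ i) (𝔬 i).blkZ (hgeo i).lenle 2) (cNorm (R₀ i) (H₀ i) (𝔬 i).blkY (hgeo i).lenle 1) ((𝔬 i).D U ∘ₗ Hop)
        (fun a b => (B₃ * B₃ * c + θ' * (B₃ * B₃ * c * (1 - θ * c)⁻¹) * c) * Real.exp (-(ρ * (geo i).dist a b))) →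
      B9.Ineq3133 d Hk' Bout Bβo δout U ∧ HasRWExpHOfOps (𝔬 i) Hk' U δout := by
    intro Hk' Hop hK hc0 hc1 hH0 hH1
    have h0 := hk_e0_of_hasMaj_rel (hgeo i) hKH0 hLc2 hc0 (hRdist i) hST2 hH0
    have h1 := hk_e1_of_hasMaj_rel (hgeo i) hKH1 hLc2 hc1 (hRdist i) (hRlen i) hST2 hH1
    have hsup := ineq3133_sup_of_entries (hgeo i).lenpos (hCHle hKH0le) (hCHle hKH1le) h0 h1
    have hhol : ∀ (β : ℝ) (ζ : (geo i).Cut) (y y' : (geo i).Site), 0 ≤ β → β < 1 → (geo i).cutInT ζ y →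
        Hk'.h U β ζ y' ≤ Bβo β * (geo i).cutH β ζ * ((geo i).len y) ^ (-(1 + β)) * ((geo i).len y') ^ (-(d : ℝ)) *
          Real.exp (-(δ₁ / 2 * (geo i).dist y y')) := by
      intro β ζ y y' h0' h1' hζ
      refine (hresH Hk' hK β ζ y y' h0' h1' hζ).trans ?_
      have hnn : 0 ≤ (geo i).cutH β ζ * ((geo i).len y) ^ (-(1 + β)) * ((geo i).len y') ^ (-(d : ℝ)) *
          Real.exp (-(δ₁ / 2 * (geo i).dist y y')) :=
        mul_nonneg (mul_nonneg (mul_nonneg ((S i).cutH_nonneg β ζ) (Real.rpow_nonneg (hlen y) _)) (Real.rpow_nonneg (hlen y') _))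
          (Real.exp_nonneg _)
      have h := mul_le_mul_of_nonneg_right (le_max_right ((m : ℝ) * (Bh β + tH * (2 * B₀) * c)) (Bβ β)) hnn
      calc Bβ β * (geo i).cutH β ζ * ((geo i).len y) ^ (-(1 + β)) * ((geo i).len y') ^ (-(d : ℝ)) * Real.exp (-(δ₁ / 2 * (geo i).dist y y'))
          = Bβ β * ((geo i).cutH β ζ * ((geo i).len y) ^ (-(1 + β)) * ((geo i).len y') ^ (-(d : ℝ)) *
              Real.exp (-(δ₁ / 2 * (geo i).dist y y'))) := by ring
        _ ≤ Bβo β * ((geo i).cutH β ζ * ((geo i).len y) ^ (-(1 + β)) * ((geo i).len y') ^ (-(d : ℝ)) *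
              Real.exp (-(δ₁ / 2 * (geo i).dist y y'))) := h
        _ = Bβo β * (geo i).cutH β ζ * ((geo i).len y) ^ (-(1 + β)) * ((geo i).len y') ^ (-(d : ℝ)) *
              Real.exp (-(δ₁ / 2 * (geo i).dist y y')) := by ring
    exact ⟨ineq3133_of_parts (S i) d (hgeo i).lenpos le_rfl hBout0 hBβo0 hτ hδδ₁ hsup hhol,
      hasRWExpH_of_schemas (hgeo i) hrowi hθ hσδ hq1 hS2 hI Hk' δout⟩
  have hH0m : HasMaj (cNorm (R₀ i) (H₀ i) (𝔬 i).blkZ (hgeo i).lenle 2) (cNorm (R₀ i) (H₀ i) (𝔬 i).blk (hgeo i).lenle 2) ((𝔬 i).Hm U)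
      (fun a b => B₃ * B₃ * c * (1 - θ * c)⁻¹ * Real.exp (-(ρ * (geo i).dist a b))) := by
    rw [hI.eq126]
    exact H_entry0 (hgeo i) hrowi hc hθ hB₃ hσ hρ.le hρ₃ hρδ hS2.step hLH.gQs2 hLH.c2 hfix hq1
  have hH1m : HasMaj (cNorm (R₀ i) (H₀ i) (𝔬 i).blkZ (hgeo i).lenle 2) (cNorm (R₀ i) (H₀ i) (𝔬 i).blkY (hgeo i).lenle 1)
      ((𝔬 i).D U ∘ₗ (𝔬 i).Hm U)
      (fun a b => (B₃ * B₃ * c + θ' * (B₃ * B₃ * c * (1 - θ * c)⁻¹) * c) * Real.exp (-(ρ * (geo i).dist a b))) := by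
    rw [hI.eq126]
    exact H_entry1 (hgeo i) hrowi hc hθ hθ' hB₃ hσ hρ.le hρ₃ hρδ hS2.step hLS.stepD hLH.gQs2 hLH.dgQs hLH.c2 hfix hq1
  have hH10m : HasMaj (cNorm (R₀ i) (H₀ i) (𝔬 i).blkZ (hgeo i).lenle 2) (cNorm (R₀ i) (H₀ i) (𝔬 i).blk (hgeo i).lenle 2) ((𝔬 i).H1m U)
      (fun a b => B₃ * B₃ * c * (1 - θ * c)⁻¹ * Real.exp (-(ρ * (geo i).dist a b))) := by
    rw [hI.eq129]
    exact H_entry0 (hgeo i) hrowi hc hθ hB₃ hσ hρ.le hρ₃ hρδ hS2.step1 hLH.gQs2 hLH.c12 hfix1 hq1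
  have hH11m : HasMaj (cNorm (R₀ i) (H₀ i) (𝔬 i).blkZ (hgeo i).lenle 2) (cNorm (R₀ i) (H₀ i) (𝔬 i).blkY (hgeo i).lenle 1)
      ((𝔬 i).D U ∘ₗ (𝔬 i).H1m U)
      (fun a b => (B₃ * B₃ * c + θ' * (B₃ * B₃ * c * (1 - θ * c)⁻¹) * c) * Real.exp (-(ρ * (geo i).dist a b))) := by
    rw [hI.eq129]
    exact H_entry1 (hgeo i) hrowi hc hθ hθ' hB₃ hσ hρ.le hρ₃ hρδ hS2.step1 hLS.stepD1 hLH.gQs2 hLH.dgQs hLH.c12 hfix1 hq1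
  refine ⟨fun K hK => ?_, fun Hk' hK' => ?_⟩
  · have hK2 : K = GD i ∨ K = G₁ i := by simpa using hK
    rcases hK2 with rfl | rfl
    · exact resK _ _ _ hI.invG clG0 clG1 clG2 (globK hgD0 hM0 hgD1 hM1 hgD2 hM2) hS1.step hS2.step hLS.stepD hStH.pY hStH.pX
        hStH.tD hStL.t hsymG htrG hlD0 hlD1 hlD2 hlD3 hlD4 hlD5 hH1D hIRD
    · exact resK _ _ _ hI.invG1 clG10 clG11 clG12 (globK hg10 hM10 hg11 hM11 hg12 hM12) hS1.step1 hS2.step1 hLS.stepD1 hStH.pY1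
        hStH.pX1 hStH.tD1 hStL.t1 hsymG1 htrG1 hl10 hl11 hl12 hl13 hl14 hl15 hH11 hIR1
  · have hK2 : Hk' = Hk i ∨ Hk' = H₁k i := by simpa using hK'
    rcases hK2 with rfl | rfl
    · exact resH _ _ hK' hcH0 hcH1 hH0m hH1m
    · exact resH _ _ hK' hcH10 hcH11 hH10m hH11m

end Family

end

end Literature.MathematicalPhysics.QuantumFieldTheory.Balaban1983to89.B9Thm312WholeLeafAll
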